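import Mathlib.Algebra.Group.Action.End
import Literature.IUT.HodgeArakelov.KummerStructures
import Summits.ABC.IUTFork.LanaLocalUnits
import HarnessLib

/-!
# L-LANA objects II quater: LANA's compact structure IS [IUTchII] Def. 4.9 (i)'s `{I^κ_H}`, and (Ind2)'s group IS `Ism`

Record-only file (D-0012) of the abc-iut cell (seat abc-iut-c312-4, L-LANA level; DICTIONARY between
LLANA-SPEC N4 and the corpus layer L6's [IUTchII] Def. 4.9 (i), `Literature/IUT/HodgeArakelov/KummerStructures.lean`);
TAKES NO SIDE on [IUTchIII] Cor. 3.12. Project LANA (bib `LANA2026Report`) Def. 3.9.1 p. 22 cites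
"[IUTchII, Def. 4.9, (viii), p. 384] (`F^{⊩▶×μ}`-prime-strips)" for the `×μ`-Kummer structure, and §6 p. 31
(Ind2) for "the automorphism group of `O^×_v` as a monoid with `G_v`-action (compatibly with the compact
structure)". The L6 typing of Def. 4.9 (i) (p. 154 of the kurims text) has: `ModTorsion U = U/U^μ`,
`actionModTorsion ρ`, `invariantLattice ρ H = Im(U^H) ⊆ U^{×μ}`, and `isometryGroup ρ 𝓗 = Ism` ("`G`-equivariant
automorphisms of `U^{×μ}` preserving the lattice `Im(U^H)` for every `H ∈ 𝓗`", [IUTchII] Ex. 1.8 (iv)).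
PROVED here, for the reference datum of `LanaLocalUnits` (`U = O^×` with its `G_v`-action, `ρ :=` Mathlib's
`MulDistribMulAction.toMulAut`):

* `unitInvariants_eq_fixedBy` — LANA's `(O^×)^H` = L6's `fixedBy ρ H`;
* `kummerStructure_eq_invariantLattice` — **LANA's `I^κ_H` = [IUTchII]'s lattice `Im((O^×)^H)`** (same
  subgroup of the same type `O^× ⧸ torsion`);
* `smul_eq_actionModTorsion` — LANA's descended `G_v`-action on `O^{×μ}` = L6's `actionModTorsion ρ`;
* `mem_isometryGroup_iff_lana` — **membership in `Ism` ⟺ `G_v`-equivariance + preservation of every `I^κ_H`,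
  `H ∈ 𝓗`** — i.e. LANA's (Ind2) automorphisms read on `O^{×μ}_v` (`LanaThetaLink.RefAut.ind2_of_ind1_trivial`)
  are exactly Mochizuki's `G`-isometries, the group through which [IUTchIII] Thm. 3.11 (i) lets (Ind2) act.

[cite: LANA2026Report, Def. 3.9.1 p. 22, §6 (Ind2) p. 31] [claim: Mochizuki2012, status: disputed]
(Def. 4.9 (i) is a definition; nothing disputed is asserted.) NOT here: topologies (L6 suppresses them too),
any judgement.
-/

namespace Summit.ABC
namespace IUTFork

open Literature.IUT.HodgeArakelov

variable {K : Type} [Field K] {Γ₀ : Type} [LinearOrderedCommGroupWithZero Γ₀] (w : Valuation K Γ₀)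
  (G : Type) [Group G] [MulSemiringAction G K] [IsValPreserving w G]

/-- The `G_v`-module structure of `O^×` as a homomorphism `ρ : G_v →* MulAut(O^×)` (the form in which L6's
Def. 4.9 (i) file records actions). [cite: LANA2026Report, §3.6 p. 19] -/
abbrev unitRho : G →* MulAut (unitGrp w) := MulDistribMulAction.toMulAut G (unitGrp w)

/-- `ρ(g)(u) = g·u`. [folklore] -/
@[simp] theorem unitRho_apply (g : G) (u : unitGrp w) : unitRho w G g u = g • u := rfl

/-- **LANA `(O^×)^H` = [IUTchII] Def. 4.9 (i) `U^H`** (`fixedBy ρ H`).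
[cite: LANA2026Report, Def. 3.9.1 p. 22] -/
theorem unitInvariants_eq_fixedBy (H : Subgroup G) : unitInvariants w G H = fixedBy (unitRho w G) H := by
  ext u
  rw [mem_unitInvariants_iff, mem_fixedBy]
  constructor
  · intro h g hg
    exact h ⟨g, hg⟩
  · intro h g
    exact h g g.2

/-- **LANA's `×μ`-Kummer structure `I^κ_H` = [IUTchII]'s lattice `Im(U^H) ⊆ U^{×μ}`** (`invariantLattice ρ H`):
the same subgroup of `O^× ⧸ O^μ`. [cite: LANA2026Report, Def. 3.9.1 p. 22] -/
theorem kummerStructure_eq_invariantLattice (H : Subgroup G) :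
    kummerStructure w G H = invariantLattice (unitRho w G) H := by
  rw [kummerStructure, invariantLattice, unitInvariants_eq_fixedBy]

/-- **LANA's descended action = [IUTchII]'s `actionModTorsion`** on `O^{×μ} = O^×/O^μ`.
[cite: LANA2026Report, §3.6 p. 20] -/
theorem smul_eq_actionModTorsion (g : G) (q : UnitsModTorsion w) :
    g • q = actionModTorsion (unitRho w G) g q := by
  induction q using QuotientGroup.induction_on with
  | H u => rw [UnitsModTorsion.smul_mk, actionModTorsion_mk, unitRho_apply]

/-- **(Ind2) read on `O^{×μ}_v` = membership in `Ism`**: an automorphism `φ` of `O^{×μ}_v` lies in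
[IUTchII]'s `Ism(G_v)` (relative to a family `𝓗` of subgroups) iff it is `G_v`-equivariant for LANA's action
and preserves LANA's `I^κ_H` for every `H ∈ 𝓗` — the shape of `LanaThetaLink.RefAut.ind2` components
("automorphism … as a monoid with `G_v`-action (compatibly with the compact structure)", §6 p. 31).
[cite: LANA2026Report, §6 (Ind2) p. 31] -/
theorem mem_isometryGroup_iff_lana (𝓗 : Set (Subgroup G)) (φ : MulAut (UnitsModTorsion w)) :
    φ ∈ isometryGroup (unitRho w G) 𝓗 ↔
      (∀ (g : G) (q : UnitsModTorsion w), φ (g • q) = g • φ q) ∧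
        ∀ H ∈ 𝓗, (kummerStructure w G H).map φ.toMonoidHom = kummerStructure w G H := by
  rw [mem_isometryGroup]
  constructor
  · rintro ⟨hcomm, hlat⟩
    refine ⟨fun g q => ?_, fun H hH => ?_⟩
    · have h := congrArg (fun ψ : MulAut (UnitsModTorsion w) => ψ q) (hcomm g)
      simp only [MulAut.mul_apply] at h
      rw [smul_eq_actionModTorsion, smul_eq_actionModTorsion]
      exact h
    · rw [kummerStructure_eq_invariantLattice]
      exact hlat H hH
  · rintro ⟨hcomm, hlat⟩
    refine ⟨fun g => ?_, fun H hH => ?_⟩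
    · apply MulEquiv.ext
      intro q
      rw [MulAut.mul_apply, MulAut.mul_apply, ← smul_eq_actionModTorsion, ← smul_eq_actionModTorsion]
      exact hcomm g q
    · rw [← kummerStructure_eq_invariantLattice]
      exact hlat H hH

end IUTFork

end Summit.ABC
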